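/-
Copyright (c) 2026. All rights reserved.
Released under Apache 2.0 license as described in the file LICENSE.
-/
import Literature.AlgebraicGeometry.Pohlmann1968.MultiquadraticCMFieldSimpleDegenerateAbelianVarieties
import Literature.AlgebraicGeometry.Pohlmann1968.DegenerateCMTypesAbelianFieldSporadicCycles
import HarnessLib

/-!
# Simple abelian varieties with multiquadratic complex multiplication carrying an exceptional Hodge class ON
# THEMSELVES exist exactly in the dimensions `2ⁿ`, `n ≥ 4`

SETTING (tree `MultiquadraticCMFieldSimpleDegenerateAbelianVarieties`, g39-#4).  `K` a CM field, Galois over `ℚ` with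
`Gal(K/ℚ)` of exponent `2` (a multiquadratic CM field, `[K:ℚ] = 2^{n+1}`).  The tree shows: PRIMITIVE DEGENERATE CM
types of `K` exist iff `[K:ℚ] ≥ 32` (`exists_isPrimitive_not_isNondegenerate_iff_le_finrank`), their abelian varieties
are SIMPLE of dimension `[K:ℚ]/2`, and — through the any-CM-field theorem
`exists_exceptional_pow_of_not_isNondegenerate` — SOME POWER carries an exceptional Hodge class.  Since `K` is
ABELIAN, S. P. White's sporadic cycles ([White1993SporadicCycles] §4 Thm. 3; tree
`AbelianCMField.exists_exceptional_of_not_isNondegenerate`, after Pohlmann [Pohlmann1968] Thm. 1) put the class on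
`A` ITSELF:

> **Theorem** (`exists_isSimple_exceptional_self_iff_le_finrank`).  For a multiquadratic CM field `K`: there is a
> SIMPLE abelian variety `A` of some CM type `(K; Φ)` carrying a rational `(m,m)`-class outside `Dᵐ(A) ⊗ ℂ` (an
> exceptional Hodge class ON `A`) **iff `[K:ℚ] ≥ 32`**; for `[K:ℚ] ≥ 32` every abelian variety of the primitive type
> of rank `[K:ℚ]/4 + 3` of the tree is such an `A` (`exceptional_self_of_isPrimitive_not_isNondegenerate`,
> `exists_simple_exceptional_self_of_le_finrank`), in particular simple `16`-folds for `[K:ℚ] = 32`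
> (`exists_simple_sixteenfold_exceptional_self_of_finrank_eq_thirtytwo`).

Conversely for `[K:ℚ] ≤ 16` NO simple abelian variety with CM by `K` has an exceptional class, even on a power (tree
`MultiquadraticCMFieldDegreeLeSixteenHodgeConjecture`), so `16 = 2⁴` is the least dimension of a simple abelian variety
with multiquadratic complex multiplication and a non-divisorial Hodge class.

* `exceptional_self_of_isPrimitive_not_isNondegenerate`, `exceptional_self_of_isSimple_not_isNondegenerate` (White's
  theorem specialised: multiquadratic `K`, primitive∕simple + degenerate ⟹ exceptional class on `A`),
  **`exists_simple_exceptional_self_of_le_finrank`**, `exists_simple_sixteenfold_exceptional_self_of_finrank_eq_thirtytwo`,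
  **`exists_isSimple_exceptional_self_iff_le_finrank`**.

HONEST SCOPE.  Assembly of g39-#4 with White's theorem (tree); the algebraicity of these classes (the Hodge
conjecture for these simple `2ⁿ`-folds) is open and not addressed.  THEOREMS ONLY: no definition, no named fact, no
instance, no `sorry`.

## References

* [White1993SporadicCycles] S. P. White, *Sporadic cycles on CM abelian varieties*, Compositio Math. 88 (1993), §4 Thm. 3.
* [Pohlmann1968] H. Pohlmann, *Algebraic cycles on abelian varieties of complex multiplication type*, Ann. of Math. 88
  (1968), Thm. 1, §3.
* [Gordon1999HodgeAVSurvey] B. B. Gordon, *A survey of the Hodge conjecture for abelian varieties*, §9.2, Prop. 9.4.1.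
* [Kubota1965] T. Kubota, *On the field extension by complex multiplication*, Trans. AMS 118 (1965), §2, §4 Lemma 2.
* [Shimura1998] G. Shimura, *Abelian Varieties with Complex Multiplication and Modular Functions*, §8.2 Prop. 26.

## Provenance

Lane `lit-hodgefound` (Track 2, Layer A5), seat `lit-hodgefound-p10` generation 39, row g39-#10; neighbours cited by
name, nothing restated: `MultiquadraticCMFieldSimpleDegenerateAbelianVarieties` (g39-#4:
`exists_isPrimitive_cmTypeRank_eq_finrank_div_four_add_three`, `exists_isPrimitive_cmTypeRank_eq_eleven`,
`isNondegenerate_of_isPrimitive_of_finrank_lt`, `isAbelianGalois_of_forall_sq_eq_one` via its imports),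
`DegenerateCMTypesAbelianFieldSporadicCycles` (`AbelianCMField.exists_exceptional_of_not_isNondegenerate`),
`PrimitiveCMTypeSimple` (`isSimple_iff_isPrimitive`), `Motives` (`schemeDim_eq_holds`),
`ComplexMultiplication` (`exists_isCMTypeRealisation`).
-/

open scoped BigOperators NumberField IsMulCommutative Classical
open NumberField Module CategoryTheory CategoryTheory.Limits IntermediateField

namespace Literature.AlgebraicGeometry.Pohlmann1968

namespace Multiquadratic

open scoped Literature.NumberTheory.ComplexMultiplication
open Literature.NumberTheory.ComplexMultiplication (IsPrimitive)
open Literature.AlgebraicGeometry.Motives (CMType AbelianVariety)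
open Literature.AlgebraicGeometry.HodgeTheory
open Literature.AlgebraicGeometry.VanGeemen1994 (hodgeClassSpan)
open Literature.Barriers.HodgeConjecture (divisorClassesSpan)
open Literature.AlgebraicGeometry.ComplexMultiplication (IsCMTypeRealisation isSimple_iff_isPrimitive
  exists_isCMTypeRealisation)

variable {K : Type} [Field K] [NumberField K] [IsCMField K] [IsGalois ℚ K]
  {A : AbelianVariety ℂ} {ι : 𝓞 K →+* End A} {θ : K →+* Module.End ℂ (complexBetti A.X 1)}

/-- **White's theorem for multiquadratic CM fields**: a PRIMITIVE DEGENERATE type `Φ` puts an exceptional Hodge class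
on EVERY abelian variety `A` of type `(K; Φ)` itself (`K` abelian since `Gal(K/ℚ)` has exponent `2`).
[cite: White1993SporadicCycles, §4 Theorem 3] [cite: Pohlmann1968, Thm. 1 and §3] -/
theorem exceptional_self_of_isPrimitive_not_isNondegenerate (hexp : ∀ g : K ≃ₐ[ℚ] K, g ^ 2 = 1) {Φ : CMType K}
    {φ₀ : K →+* ℂ} (hprim : IsPrimitive (ℂ ≃+* ℂ) Φ.1 φ₀) (hnd : ¬ IsNondegenerate Φ)
    (hA : IsCMTypeRealisation Φ A ι θ) :
    ∃ m : ℕ, ∃ c : complexBetti A.X (2 * m), IsRationalClass c ∧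
      IsOfHodgeType (finrank ℚ K / 2) A.X (2 * m) m m c ∧ c ∉ divisorClassesSpan A.X (finrank ℚ K / 2) m := by
  haveI := isAbelianGalois_of_forall_sq_eq_one hexp
  exact AbelianCMField.exists_exceptional_of_not_isNondegenerate hprim hnd hA

/-- The same with `A` SIMPLE as the hypothesis. [cite: White1993SporadicCycles, §4 Theorem 3] [cite: Shimura1998, §8.2 Prop. 26] -/
theorem exceptional_self_of_isSimple_not_isNondegenerate (hexp : ∀ g : K ≃ₐ[ℚ] K, g ^ 2 = 1) {Φ : CMType K}
    (hA : IsCMTypeRealisation Φ A ι θ) (hS : A.IsSimple) (hnd : ¬ IsNondegenerate Φ) :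
    ∃ m : ℕ, ∃ c : complexBetti A.X (2 * m), IsRationalClass c ∧
      IsOfHodgeType (finrank ℚ K / 2) A.X (2 * m) m m c ∧ c ∉ divisorClassesSpan A.X (finrank ℚ K / 2) m := by
  obtain ⟨φ₀⟩ : Nonempty (K →+* ℂ) := inferInstance
  exact exceptional_self_of_isPrimitive_not_isNondegenerate hexp ((isSimple_iff_isPrimitive hA φ₀).1 hS) hnd hA

/-- **`[K:ℚ] ≥ 32`: a CM type of rank `[K:ℚ]/4 + 3` all of whose abelian varieties are SIMPLE of dimension `[K:ℚ]/2`
and carry an exceptional Hodge class ON THEMSELVES.** [cite: White1993SporadicCycles, §4 Theorem 3]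
[cite: Kubota1965, §2 and §4 Lemma 2] [cite: Shimura1998, §8.2 Prop. 26] -/
theorem exists_simple_exceptional_self_of_le_finrank (hexp : ∀ g : K ≃ₐ[ℚ] K, g ^ 2 = 1)
    (h32 : 32 ≤ finrank ℚ K) :
    ∃ Φ : CMType K, cmTypeRank Φ = finrank ℚ K / 4 + 3 ∧ ¬ IsNondegenerate Φ ∧
      ∀ (A : AbelianVariety ℂ) (ι : 𝓞 K →+* End A) (θ : K →+* Module.End ℂ (complexBetti A.X 1)),
        IsCMTypeRealisation Φ A ι θ →
          A.IsSimple ∧ A.dim = finrank ℚ K / 2 ∧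
            ∃ m : ℕ, ∃ c : complexBetti A.X (2 * m), IsRationalClass c ∧
              IsOfHodgeType (finrank ℚ K / 2) A.X (2 * m) m m c ∧ c ∉ divisorClassesSpan A.X (finrank ℚ K / 2) m := by
  obtain ⟨Φ, hr, hnd, hprim⟩ := exists_isPrimitive_cmTypeRank_eq_finrank_div_four_add_three hexp h32
  refine ⟨Φ, hr, hnd, fun A ι θ hA => ⟨?_, ?_, ?_⟩⟩
  · obtain ⟨φ₀⟩ := (inferInstance : Nonempty (K →+* ℂ))
    exact (isSimple_iff_isPrimitive hA φ₀).2 (hprim φ₀)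
  · exact Literature.AlgebraicGeometry.Motives.schemeDim_eq_holds hA.1
  · obtain ⟨φ₀⟩ := (inferInstance : Nonempty (K →+* ℂ))
    exact exceptional_self_of_isPrimitive_not_isNondegenerate hexp (hprim φ₀) hnd hA

/-- **`[K:ℚ] = 32`: simple `16`-folds with multiquadratic complex multiplication and an exceptional Hodge class on
themselves exist** (of the primitive rank-`11` type; unconditional, Shimura's existence of abelian varieties of a given
type). [cite: White1993SporadicCycles, §4 Theorem 3] [cite: Shimura1998, §6.2 Thm. 3 and §8.2 Prop. 26] -/
theorem exists_simple_sixteenfold_exceptional_self_of_finrank_eq_thirtytwo (hexp : ∀ g : K ≃ₐ[ℚ] K, g ^ 2 = 1)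
    (h32 : finrank ℚ K = 32) :
    ∃ (Φ : CMType K) (A : AbelianVariety ℂ) (ι : 𝓞 K →+* End A) (θ : K →+* Module.End ℂ (complexBetti A.X 1)),
      IsCMTypeRealisation Φ A ι θ ∧ cmTypeRank Φ = 11 ∧ A.IsSimple ∧ A.dim = 16 ∧
        ∃ m : ℕ, ∃ c : complexBetti A.X (2 * m), IsRationalClass c ∧
          IsOfHodgeType 16 A.X (2 * m) m m c ∧ c ∉ divisorClassesSpan A.X 16 m := by
  obtain ⟨Φ, hr, hnd, hall⟩ := exists_simple_exceptional_self_of_le_finrank hexp (by omega)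
  obtain ⟨A, ι, θ, hA⟩ := exists_isCMTypeRealisation Φ
  obtain ⟨hs, hd, hexc⟩ := hall A ι θ hA
  have h16 : finrank ℚ K / 2 = 16 := by omega
  rw [h16] at hd hexc
  refine ⟨Φ, A, ι, θ, hA, by omega, hs, hd, hexc⟩

/-- **SIMPLE ABELIAN VARIETIES WITH COMPLEX MULTIPLICATION BY THE MULTIQUADRATIC CM FIELD `K` CARRYING AN EXCEPTIONAL
HODGE CLASS ON THEMSELVES EXIST IFF `[K:ℚ] ≥ 32`** — i.e. exactly in the dimensions `2ⁿ`, `n ≥ 4` (`⟸`: the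
primitive degenerate types above; `⟹`: an exceptional class makes the type degenerate, tree
`IsNondegenerate.not_exists_exceptional`…, here through `exists_isSimple_not_isNondegenerate_iff_le_finrank`).
[cite: White1993SporadicCycles, §4 Theorem 3] [cite: Kubota1965, §2] [cite: Gordon1999HodgeAVSurvey, §9.2 and Prop. 9.4.1] -/
theorem exists_isSimple_exceptional_self_iff_le_finrank (hexp : ∀ g : K ≃ₐ[ℚ] K, g ^ 2 = 1) :
    (∃ (Φ : CMType K) (A : AbelianVariety ℂ) (ι : 𝓞 K →+* End A) (θ : K →+* Module.End ℂ (complexBetti A.X 1)),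
      IsCMTypeRealisation Φ A ι θ ∧ A.IsSimple ∧
        ∃ m : ℕ, ∃ c : complexBetti A.X (2 * m), IsRationalClass c ∧
          IsOfHodgeType (finrank ℚ K / 2) A.X (2 * m) m m c ∧ c ∉ divisorClassesSpan A.X (finrank ℚ K / 2) m) ↔
      32 ≤ finrank ℚ K := by
  constructor
  · rintro ⟨Φ, A, ι, θ, hA, hs, m, c, hcQ, hcH, hcD⟩
    refine (exists_isSimple_not_isNondegenerate_iff_le_finrank hexp).1 ⟨Φ, A, ι, θ, hA, hs, fun hnd => hcD ?_⟩
    -- a nondegenerate type has no exceptional class on `A = A¹`… use the divisor-generation of `A` itself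
    have h := hnd.hodgeClassSpan_eq_divisorClassesSpan hA m
    exact h ▸ Submodule.subset_span ⟨hcQ, hcH⟩
  · intro h32
    obtain ⟨Φ, -, -, hall⟩ := exists_simple_exceptional_self_of_le_finrank hexp h32
    obtain ⟨A, ι, θ, hA⟩ := exists_isCMTypeRealisation Φ
    obtain ⟨hs, -, hexc⟩ := hall A ι θ hA
    exact ⟨Φ, A, ι, θ, hA, hs, hexc⟩

end Multiquadratic

end Literature.AlgebraicGeometry.Pohlmann1968
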